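import Summits.RiemannHypothesis.RiemannHypothesis.Theorems.Splittings.ScrewLatticeTowerA
import Summits.RiemannHypothesis.RiemannHypothesis.Theorems.Splittings.ScrewWolffDiscreteDataB
import Mathlib.Analysis.SpecialFunctions.Complex.Log
import HarnessLib

/-!
# The rigid polygon TOWER, part B: roots of unity, rotations, the atoms and their (summable) weights

Continuation of `ScrewLatticeTowerA` (K-task «TOWER», RULING #329; memo rh-idea-5 `TOWER-BARRIER.md` §1/§5).
The atoms of the tower in the unit disc: the seed `K₀`-gon at radius `r_{K₀}` (vertex mass `1/K₀`) and, for every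
live order `n ≥ K₀` (`x_n ≠ 0`), the regular `n`-gon at radius `r_n = 1 - 1/(c n)` rotated by `0` (`x_n < 0`) or
`π/n` (`x_n > 0`), vertex mass `|x_n|/(n r_nⁿ)`.  THEOREMS here: all weights positive (`wt_pos`) and summable
(`summable_wt`, depth `e^{-1/c} ≤ 1/18`, `c K₀ ≥ 2`, via the floor `r_nⁿ ≥ e^{-2/c}`); INFINITELY MANY GONS ARE
LIVE (`exists_live_gt`: the radii of the atoms have an unattained supremum — dominance of the outermost live gon at
the frequencies `N(t+1)`).  Part C: vanishing moments, discreteness, the packaged data theorem.  ζ-free, RH-free;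
std axioms.  Nothing here bears on the truth of RH.
-/

set_option linter.dupNamespace false

namespace Summit.RiemannHypothesis.RiemannHypothesis.Theorems.Splittings.ScrewLatticeTower

open Complex Finset Filter Topology
open Summit.RiemannHypothesis.RiemannHypothesis.Theorems.Splittings.ScrewWolffDiscreteData (ω norm_ω sum_ω_pow)

noncomputable section

/-! ## 4. Rotations and the floor `r_nⁿ ≥ e^{-2/c}` (roots of unity `ω`, `sum_ω_pow` are the divisor rings') -/

/-- The rotation of the gon of order `n` built on the residual `x`: `e^{iπ/n}` if `x > 0`, `1` otherwise. -/
def rot (n : ℕ) (x : ℝ) : ℂ := if 0 < x then Complex.exp (Real.pi * I / n) else 1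

/-- The rotation has norm one. -/
theorem norm_rot (n : ℕ) (x : ℝ) : ‖rot n x‖ = 1 := by
  unfold rot
  split_ifs
  · rw [show (Real.pi * I / n : ℂ) = ((Real.pi / n : ℝ) : ℂ) * I by push_cast; ring,
      Complex.norm_exp_ofReal_mul_I]
  · simp

/-- The `n·m`-th power of the rotation is the sign: `(rot n x)^{n m} = (sgn x)^m`. -/
theorem rot_pow {n : ℕ} (hn : 1 ≤ n) (x : ℝ) (m : ℕ) : rot n x ^ (n * m) = ((sgn x : ℝ) : ℂ) ^ m := by
  unfold rot sgn
  split_ifs with h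
  · rw [pow_mul, ← Complex.exp_nat_mul]
    have hn0 : (n : ℂ) ≠ 0 := by exact_mod_cast (show n ≠ 0 by omega)
    have : (n : ℂ) * (Real.pi * I / n) = Real.pi * I := by field_simp
    rw [this, Complex.exp_pi_mul_I]
    push_cast
    ring
  · push_cast; simp

/-- The floor `e^{-2/c} ≤ r_nⁿ` for `c n ≥ 2` (from `log y ≥ 1 - 1/y`). -/
theorem exp_le_rad_pow {c : ℝ} (hc : 0 < c) {n : ℕ} (hn : 2 ≤ c * n) : Real.exp (-(2 / c)) ≤ rad c n ^ n := by
  have hcn : 0 < c * n := by linarith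
  have hn0 : (0 : ℝ) < n := by
    rcases Nat.eq_zero_or_pos n with h | h
    · subst h; simp at hn; linarith
    · exact_mod_cast h
  have hr : 0 < rad c n := rad_pos (by linarith)
  have hu : 1 / (c * n) ≤ 1 / 2 := by
    rw [div_le_div_iff₀ hcn two_pos]; linarith
  -- `log r_n ≥ 1 - 1/r_n = -u/(1-u) ≥ -2u`, `u = 1/(cn)`
  have hlog : -(2 / (c * n)) ≤ Real.log (rad c n) := by
    have h1 := Real.one_sub_inv_le_log_of_pos hr
    have h2 : -(2 / (c * n)) ≤ 1 - (rad c n)⁻¹ := by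
      set u : ℝ := 1 / (c * n) with hu_def
      have hu0 : 0 ≤ u := by positivity
      have hpos : 0 < 1 - u := by simpa [rad, hu_def] using hr
      have hinv : 1 / (1 - u) ≤ 1 + 2 * u := by
        rw [div_le_iff₀ hpos]; nlinarith
      have hrad : rad c n = 1 - u := by simp [rad, hu_def]
      rw [hrad, inv_eq_one_div]
      have : 2 / (c * n) = 2 * u := by rw [hu_def]; ring
      rw [this]; linarith
    linarith
  calc Real.exp (-(2 / c)) = Real.exp (n * (-(2 / (c * n)))) := by congr 1; field_simp
    _ ≤ Real.exp (n * Real.log (rad c n)) := Real.exp_le_exp.mpr (by nlinarith)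
    _ = rad c n ^ n := by rw [Real.exp_nat_mul, Real.exp_log hr]

/-! ## 5. The atoms and their weights -/

/-- Live gon orders (`x_n ≠ 0`, hence `n ≥ K₀`). -/
abbrev Live (c : ℝ) (K₀ : ℕ) : Type := {n : ℕ // res c K₀ n ≠ 0}

/-- Index type of the atoms: `K₀` seed vertices and `n` vertices on each live gon `n`. -/
abbrev Idx (c : ℝ) (K₀ : ℕ) : Type := Fin K₀ ⊕ (Σ n : Live c K₀, Fin n.1)

/-- The atoms (unit-disc normalisation). -/
def atom (c : ℝ) (K₀ : ℕ) : Idx c K₀ → ℂ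
  | Sum.inl l => (rad c K₀ : ℂ) * ω K₀ ^ (l : ℕ)
  | Sum.inr ⟨n, l⟩ => (rad c n.1 : ℂ) * rot n.1 (res c K₀ n.1) * ω n.1 ^ (l : ℕ)

/-- The weights (vertex masses): `1/K₀` on the seed, `|x_n|/(n r_nⁿ)` on gon `n`. -/
def wt (c : ℝ) (K₀ : ℕ) : Idx c K₀ → ℝ
  | Sum.inl _ => 1 / (K₀ : ℝ)
  | Sum.inr ⟨n, _⟩ => |res c K₀ n.1| / ((n.1 : ℝ) * rad c n.1 ^ n.1)

/-- The order (level) of an atom (`K₀` for the seed). -/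
def level {c : ℝ} {K₀ : ℕ} : Idx c K₀ → ℕ
  | Sum.inl _ => K₀
  | Sum.inr ⟨n, _⟩ => n.1

/-- Every atom has level at least `K₀`. -/
theorem le_level {c : ℝ} {K₀ : ℕ} (i : Idx c K₀) : K₀ ≤ level i := by
  rcases i with l | ⟨n, l⟩
  · simp [level]
  · simp only [level]; exact le_of_res_ne_zero n.2

/-- An atom of level `n` lies on the circle of radius `r_n`. -/
theorem norm_atom {c : ℝ} (hc : 0 < c) {K₀ : ℕ} (hK : 1 < c * K₀) (i : Idx c K₀) :
    ‖atom c K₀ i‖ = rad c (level i) := by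
  have hK1 : 1 ≤ K₀ := by
    by_contra h
    have : K₀ = 0 := by omega
    subst this; simp at hK; linarith
  rcases i with l | ⟨n, l⟩
  · simp only [atom, level, norm_mul, norm_pow, norm_ω, one_pow, mul_one, Complex.norm_real, Real.norm_eq_abs,
      abs_of_pos (rad_pos hK)]
  · have hn : 1 < c * n.1 := lt_of_lt_of_le hK (by gcongr; exact le_of_res_ne_zero n.2)
    simp only [atom, level, norm_mul, norm_pow, norm_ω, norm_rot, one_pow, mul_one, Complex.norm_real,
      Real.norm_eq_abs, abs_of_pos (rad_pos hn)]

/-- All atom weights are positive. -/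
theorem wt_pos {c : ℝ} (hc : 0 < c) {K₀ : ℕ} (hK : 1 < c * K₀) (i : Idx c K₀) : 0 < wt c K₀ i := by
  have hK1 : 1 ≤ K₀ := by
    by_contra h
    have : K₀ = 0 := by omega
    subst this; simp at hK; linarith
  have : (0 : ℝ) < K₀ := by exact_mod_cast hK1
  rcases i with l | ⟨n, l⟩
  · simp only [wt]; positivity
  · simp only [wt]
    have h2 := le_of_res_ne_zero n.2
    have hn : 1 < c * n.1 := lt_of_lt_of_le hK (by gcongr)
    have : (0 : ℝ) < n.1 := by exact_mod_cast (show 0 < n.1 by omega)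
    have : 0 < rad c n.1 := rad_pos hn
    exact div_pos (abs_pos.mpr n.2) (by positivity)

/-! ## 6. Summability of the weights (finite total mass) -/

/-- The atom weights are summable (depth `e^{-1/c} ≤ 1/18`, seed order with `c K₀ ≥ 2`): the seed carries mass
`1`, gon `n` carries `|x_n|/r_nⁿ ≤ e^{2/c} |x_n|`, and `Σ |x_n| < ∞` (`summable_abs_res`). -/
theorem summable_wt {c : ℝ} (hc : 0 < c) (hx : Real.exp (-(1 / c)) ≤ 1 / 18) {K₀ : ℕ} (hK : 2 ≤ c * K₀) :
    Summable (wt c K₀) := by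
  have hK' : 1 < c * K₀ := by linarith
  refine Summable.sum _ ?_ ?_
  · exact (hasSum_fintype _).summable
  · have hnn : ∀ y : (Σ n : Live c K₀, Fin n.1), 0 ≤ (wt c K₀ ∘ Sum.inr) y :=
      fun y ↦ (wt_pos hc hK' (Sum.inr y)).le
    refine (summable_sigma_of_nonneg hnn).2 ⟨fun n ↦ (hasSum_fintype _).summable, ?_⟩
    have heq : (fun n : Live c K₀ ↦ ∑' l : Fin n.1, (wt c K₀ ∘ Sum.inr) ⟨n, l⟩)
        = fun n : Live c K₀ ↦ |res c K₀ n.1| / rad c n.1 ^ n.1 := by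
      funext n
      rw [tsum_fintype]
      simp only [Function.comp, wt, Finset.sum_const, Finset.card_univ, Fintype.card_fin, nsmul_eq_mul]
      have h2 := le_of_res_ne_zero n.2
      have hn : 1 < c * n.1 := lt_of_lt_of_le hK' (by gcongr)
      have : (0 : ℝ) < n.1 := by
        have : (0 : ℝ) < c * n.1 := by linarith
        nlinarith
      have : 0 < rad c n.1 := rad_pos hn
      field_simp
    rw [heq]
    -- compare with `e^{2/c} |x_n|`
    have hbound : ∀ n : Live c K₀, |res c K₀ n.1| / rad c n.1 ^ n.1 ≤ Real.exp (2 / c) * |res c K₀ n.1| := by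
      intro n
      have h2 := le_of_res_ne_zero n.2
      have hn2 : 2 ≤ c * n.1 := le_trans hK (by gcongr)
      have hfloor := exp_le_rad_pow hc hn2
      have hpos : 0 < Real.exp (-(2 / c)) := Real.exp_pos _
      rw [div_le_iff₀ (lt_of_lt_of_le hpos hfloor)]
      calc |res c K₀ n.1| = Real.exp (2 / c) * |res c K₀ n.1| * Real.exp (-(2 / c)) := by
            rw [mul_assoc, mul_comm |res c K₀ n.1|, ← mul_assoc, ← Real.exp_add]; simp
        _ ≤ Real.exp (2 / c) * |res c K₀ n.1| * rad c n.1 ^ n.1 := by gcongr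
    refine Summable.of_nonneg_of_le (fun n ↦ ?_) hbound ?_
    · have h2 := le_of_res_ne_zero n.2
      have hn : 1 < c * n.1 := lt_of_lt_of_le hK' (by gcongr)
      exact div_nonneg (abs_nonneg _) (pow_nonneg (rad_pos hn).le _)
    · exact ((summable_abs_res hc hx (by linarith)).mul_left (Real.exp (2 / c))).comp_injective
        Subtype.val_injective

/-! ## 7. Infinitely many live gons (the radii of the atoms have an unattained supremum) -/

/-- The seed order is live: `x_{K₀} = r_{K₀}^{K₀}`. -/
theorem res_seed {c : ℝ} {K₀ : ℕ} : res c K₀ K₀ = rad c K₀ ^ K₀ := by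
  rw [res_eq le_rfl, seedMom, if_pos (dvd_refl K₀), gonSum, Finset.sum_eq_zero, add_zero]
  intro d hd
  rw [if_neg]
  have := (Nat.mem_properDivisors.1 hd).2
  omega

/-- Size of a gon term, exactly: `|term c d x k| = |x| · r_d^{k-d}` (when `r_d ≥ 0`). -/
theorem abs_term_eq {c : ℝ} {d : ℕ} (hd : 1 ≤ c * d) (x : ℝ) (k : ℕ) :
    |term c d x k| = |x| * rad c d ^ (k - d) := by
  rw [term, abs_mul, abs_mul, abs_abs, abs_pow, abs_of_nonneg (rad_nonneg hd), abs_pow, abs_sgn, one_pow,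
    mul_one]

/-- **Infinitely many gons are live**: above every bound there is an order `n` with `x_n ≠ 0`.  (If the live
orders were bounded with maximum `N > K₀`, the cancellation identity at the frequencies `N(t+1)` would force
`|x_N| ≤ M·(r_{N-1}/r_N)^{N t} → 0`; for `N = K₀` the identity at `2K₀` reads `r^{2K₀} + |x_{K₀}| r^{K₀} = 0`.) -/
theorem exists_live_gt {c : ℝ} (hc : 0 < c) {K₀ : ℕ} (hK : 1 < c * K₀) (B : ℕ) :
    ∃ n, B < n ∧ res c K₀ n ≠ 0 := by
  have hK1 : 1 ≤ K₀ := by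
    by_contra h
    have : K₀ = 0 := by omega
    subst this; simp at hK; linarith
  have hKle : 1 ≤ c * K₀ := hK.le
  have hKpos : 0 < rad c K₀ := rad_pos hK
  have hresK : res c K₀ K₀ ≠ 0 := by rw [res_seed]; positivity
  by_contra hnone
  have hdead : ∀ n, res c K₀ n ≠ 0 → n ≤ B := fun n hn ↦ by
    by_contra h; exact hnone ⟨n, by omega, hn⟩
  -- the largest live order `N`
  set L : Finset ℕ := (Finset.range (B + 1)).filter (fun n ↦ res c K₀ n ≠ 0) with hL
  have hKL : K₀ ∈ L := by
    rw [hL, Finset.mem_filter, Finset.mem_range]; exact ⟨by have := hdead K₀ hresK; omega, hresK⟩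
  have hLne : L.Nonempty := ⟨K₀, hKL⟩
  set N := L.max' hLne with hN
  have hNL : N ∈ L := Finset.max'_mem L hLne
  have hNlive : res c K₀ N ≠ 0 := (Finset.mem_filter.1 hNL).2
  have hKN : K₀ ≤ N := Finset.le_max' L K₀ hKL
  have hmax : ∀ d, res c K₀ d ≠ 0 → d ≤ N := by
    intro d hd
    apply Finset.le_max'
    rw [hL, Finset.mem_filter, Finset.mem_range]
    exact ⟨by have := hdead d hd; omega, hd⟩
  have hN1 : 1 ≤ N := le_trans hK1 hKN
  have hcN : 1 < c * N := lt_of_lt_of_le hK (by gcongr)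
  have hNpos : 0 < rad c N := rad_pos hcN
  rcases hKN.eq_or_lt with hEq | hLt
  · -- `N = K₀`: the identity at frequency `2K₀` is `r^{2K₀} + |x_{K₀}| r^{K₀} = 0`, absurd
    have hid := moment_cancel (c := c) (K₀ := K₀) (k := 2 * K₀) (by omega)
    have hmem : K₀ ∈ Nat.divisors (2 * K₀) := Nat.mem_divisors.2 ⟨dvd_mul_left K₀ 2, by omega⟩
    have hsum : ∑ d ∈ Nat.divisors (2 * K₀), (if K₀ ≤ d then term c d (res c K₀ d) (2 * K₀) else 0)
        = term c K₀ (res c K₀ K₀) (2 * K₀) := by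
      rw [← Finset.add_sum_erase _ _ hmem, if_pos le_rfl, Finset.sum_eq_zero, add_zero]
      intro d hd
      obtain ⟨hdK, -⟩ := Finset.mem_erase.1 hd
      split_ifs with hKd
      · have hres : res c K₀ d = 0 := by
          by_contra hne
          have := hmax d hne
          omega
        rw [hres, term_zero]
      · rfl
    have hseed : seedMom c K₀ (2 * K₀) = rad c K₀ ^ (2 * K₀) := by
      rw [seedMom, if_pos (dvd_mul_left K₀ 2)]
    have hterm : 0 ≤ term c K₀ (res c K₀ K₀) (2 * K₀) := by
      rw [term, show 2 * K₀ / K₀ = 2 from Nat.mul_div_cancel 2 (by omega)]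
      have hsq : 0 ≤ sgn (res c K₀ K₀) ^ 2 := sq_nonneg _
      have := abs_nonneg (res c K₀ K₀)
      have := pow_nonneg hKpos.le (2 * K₀ - K₀)
      positivity
    rw [hsum, hseed] at hid
    have : 0 < rad c K₀ ^ (2 * K₀) := pow_pos hKpos _
    linarith
  · -- `K₀ < N`: dominance of the outermost live gon at the frequencies `N (t+1)`
    have hN2 : 1 ≤ N - 1 := by omega
    have hcN1 : 1 ≤ c * (N - 1 : ℕ) := le_trans hKle (by gcongr; omega)
    have hr1pos : 0 ≤ rad c (N - 1) := rad_nonneg hcN1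
    have hr1lt : rad c (N - 1) < rad c N := rad_lt_rad hc hN2 (by omega)
    set M : ℝ := 1 + ∑ d ∈ Finset.range N, |res c K₀ d| with hM
    have hM0 : 0 ≤ M := by positivity
    -- the key inequality at frequency `k = N (t+1)`
    have hkey : ∀ t : ℕ, |res c K₀ N| * rad c N ^ (N * t) ≤ M * rad c (N - 1) ^ (N * t) := by
      intro t
      set k := N * (t + 1) with hk
      have hkN : N ≤ k := by rw [hk]; exact Nat.le_mul_of_pos_right N (by omega)
      have hkt : k - N = N * t := by rw [hk, Nat.mul_succ, Nat.add_sub_cancel]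
      have hid := moment_cancel (c := c) (K₀ := K₀) (k := k) (by nlinarith)
      have hmem : N ∈ Nat.divisors k := Nat.mem_divisors.2 ⟨Dvd.intro _ rfl, by positivity⟩
      rw [← Finset.add_sum_erase _ _ hmem, if_pos hKN] at hid
      -- `term N = -(seed + rest)`
      have hN_eq : term c N (res c K₀ N) k = -(seedMom c K₀ k +
          ∑ d ∈ (Nat.divisors k).erase N, (if K₀ ≤ d then term c d (res c K₀ d) k else 0)) := by linarith
      -- bound each remaining term by `|x_d| r_{N-1}^{N t}` (dead orders and orders above `N` give `0`)
      have hrest : ∀ d ∈ (Nat.divisors k).erase N,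
          |(if K₀ ≤ d then term c d (res c K₀ d) k else 0)|
            ≤ (if d < N then |res c K₀ d| else 0) * rad c (N - 1) ^ (N * t) := by
        intro d hd
        obtain ⟨hdN, hdk⟩ := Finset.mem_erase.1 hd
        by_cases hlive : res c K₀ d = 0
        · have h0 : (if K₀ ≤ d then term c d (res c K₀ d) k else 0) = 0 := by
            rw [hlive, term_zero]; simp
          rw [h0, abs_zero]
          refine mul_nonneg ?_ (pow_nonneg hr1pos _)
          split_ifs
          · exact abs_nonneg _
          · exact le_rfl
        have hdle : d < N := lt_of_le_of_ne (hmax d hlive) hdN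
        have hKd : K₀ ≤ d := le_of_res_ne_zero hlive
        have hcd : 1 ≤ c * d := le_trans hKle (by gcongr)
        rw [if_pos hKd, if_pos hdle, abs_term_eq hcd]
        refine mul_le_mul_of_nonneg_left ?_ (abs_nonneg _)
        calc rad c d ^ (k - d) ≤ rad c d ^ (N * t) :=
              pow_le_pow_of_le_one (rad_nonneg hcd) (rad_lt_one hc (by omega)).le (by omega)
          _ ≤ rad c (N - 1) ^ (N * t) :=
              pow_le_pow_left₀ (rad_nonneg hcd) (rad_le_rad hc (by omega) (by omega)) _
      have hseedb : |seedMom c K₀ k| ≤ 1 * rad c (N - 1) ^ (N * t) := by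
        refine (abs_seedMom_le hKle k).trans ?_
        rw [one_mul]
        calc rad c K₀ ^ k ≤ rad c K₀ ^ (N * t) :=
              pow_le_pow_of_le_one hKpos.le (rad_lt_one hc hK1).le (by omega)
          _ ≤ rad c (N - 1) ^ (N * t) := pow_le_pow_left₀ hKpos.le (rad_le_rad hc hK1 (by omega)) _
      have hsumb : ∑ d ∈ (Nat.divisors k).erase N, (if d < N then |res c K₀ d| else 0)
          ≤ ∑ d ∈ Finset.range N, |res c K₀ d| := by
        rw [← Finset.sum_filter]
        refine Finset.sum_le_sum_of_subset_of_nonneg (fun d hd ↦ ?_) (fun _ _ _ ↦ abs_nonneg _)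
        exact Finset.mem_range.2 (Finset.mem_filter.1 hd).2
      calc |res c K₀ N| * rad c N ^ (N * t) = |term c N (res c K₀ N) k| := by
            rw [abs_term_eq hcN.le, hkt]
        _ ≤ |seedMom c K₀ k| + ∑ d ∈ (Nat.divisors k).erase N,
              |(if K₀ ≤ d then term c d (res c K₀ d) k else 0)| := by
            rw [hN_eq, abs_neg]
            exact (abs_add_le _ _).trans (add_le_add le_rfl (Finset.abs_sum_le_sum_abs _ _))
        _ ≤ 1 * rad c (N - 1) ^ (N * t) + ∑ d ∈ (Nat.divisors k).erase N,
              (if d < N then |res c K₀ d| else 0) * rad c (N - 1) ^ (N * t) :=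
            add_le_add hseedb (Finset.sum_le_sum hrest)
        _ = (1 + ∑ d ∈ (Nat.divisors k).erase N, (if d < N then |res c K₀ d| else 0))
              * rad c (N - 1) ^ (N * t) := by rw [add_mul, Finset.sum_mul]
        _ ≤ M * rad c (N - 1) ^ (N * t) := by
            rw [hM]; gcongr
    -- pass to the limit `t → ∞`: `|x_N| ≤ M q^t` with `q = (r_{N-1}/r_N)^N < 1`
    set q : ℝ := (rad c (N - 1) / rad c N) ^ N with hq
    have hq0 : 0 ≤ q := by positivity
    have hq1 : q < 1 := by
      rw [hq]
      apply pow_lt_one₀ (by positivity) _ (by omega)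
      rw [div_lt_one hNpos]; exact hr1lt
    have hle : ∀ t : ℕ, |res c K₀ N| ≤ M * q ^ t := by
      intro t
      have hpos : 0 < rad c N ^ (N * t) := pow_pos hNpos _
      have := hkey t
      rw [← le_div_iff₀ hpos] at this
      refine this.trans (le_of_eq ?_)
      rw [hq, ← pow_mul, div_pow, pow_mul, pow_mul, mul_div_assoc]
    have hlim : Tendsto (fun t : ℕ ↦ M * q ^ t) atTop (𝓝 (M * 0)) :=
      (tendsto_pow_atTop_nhds_zero_of_lt_one hq0 hq1).const_mul M
    rw [mul_zero] at hlim
    have h0 : |res c K₀ N| ≤ 0 := ge_of_tendsto' hlim hle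
    exact hNlive (abs_nonpos_iff.mp h0)

end

end Summit.RiemannHypothesis.RiemannHypothesis.Theorems.Splittings.ScrewLatticeTower
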